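import Mathlib
import HarnessLib
import Summits.NavierStokesRegularity.NavierStokesRegularity.Theorems.HalfSpaceWindowDoorCirculationCarryingRigidityConeLiouville
import Summits.NavierStokesRegularity.NavierStokesRegularity.Theorems.HalfSpaceWindowDoorCirculationCarryingRigidityRotate

/-!
# Route `HalfSpaceWindowDoor`, crux `CirculationCarryingRigidity` (stmt-NavierStokesRegularity-25311) —
# line `cone_sweep`: the cone theorem in EVERY DIRECTION (the crux's own `∀ e ≠ 0` format)

LEAD ns-hsw-p1 g9, `--supports stmt-NavierStokesRegularity-25311 --as helper`; card `Cruxes/…/Lines/cone_sweep.md`.  By the determinant-one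
rotation covariance of the door class and of `curl` (tree `class_conj_linearIsometryEquiv`, `curl_conj_linearIsometryEquiv`, the machinery of
`stub_rotate`), the `e₃`-cone theorem `…ConeLiouville.eq_zero_of_coned` holds for every direction `e ≠ 0`:

* `eq_zero_of_coned_dir` — door class (`‖v(s)‖_∞ ≤ C/√(−s)`, continuity, Oseen–Duhamel, divergence-free) + `⟪curl v, e⟫ ≥ 0` + the cone
  `‖ω − ⟪ω, ê⟫ê‖ ≤ K⟪ω, ê⟫` about `ê = e/‖e‖` everywhere (any `C`, `K ≥ 0`) ⇒ `v ≡ 0`;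
* `not_isBackwardSingularPoint_of_coned_dir` — in the crux's format: such a profile is not backward-singular at the apex.

This is the KNSS time-only analogue of Lei–Ren–Tian's Theorem 1.1 (arXiv:2501.08976: vorticity in a double cone about any great circle ⇒
regularity, for suitable weak solutions), for the one-signed cone and WITHOUT local-energy hypotheses; their Remark 1.3 (the half-space
`⟪ω, e⟫ ≥ 0` without a cone = this crux) stays OPEN.  WHAT THIS IS NOT: not about NS regularity; HYPOTHETICAL blow-up profiles.  No item closed.
-/

noncomputable section

-- the summit and its single sub-problem share the name (CONVENTIONS §1), as in every Theorems file
set_option linter.dupNamespace false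

namespace Summit.NavierStokesRegularity.NavierStokesRegularity.Theorems.HalfSpaceWindowDoorCirculationCarryingRigidityConeLiouvilleDir

open MeasureTheory Set Function Filter Topology InnerProductSpace
open scoped RealInnerProductSpace InnerProductSpace
open Literature.Analysis Literature.Analysis.FluidPDE Literature.Analysis.UnboundedOperators
open Summit.NavierStokesRegularity.NavierStokesRegularity.Theses.HalfSpaceWindowDoor
open Summit.NavierStokesRegularity.NavierStokesRegularity.Theorems.HalfSpaceWindowDoorCirculationCarryingRigidityDefs
  (InDoorClass SignE3 e3)
open Summit.NavierStokesRegularity.NavierStokesRegularity.Theorems.HalfSpaceWindowDoorCirculationCarryingRigidityGaussKernel (inner_e3_apply)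
open Summit.NavierStokesRegularity.NavierStokesRegularity.Theorems.HalfSpaceWindowDoorCirculationCarryingRigidityRotate
  (exists_linearIsometryEquiv_det_one_symm_single_two)
open Summit.NavierStokesRegularity.NavierStokesRegularity.Theorems.PoloidalWindowDoorPoloidalWindowRigidityRotate
  (class_conj_linearIsometryEquiv)
open Summit.NavierStokesRegularity.NavierStokesRegularity.Theorems.HalfSpaceWindowDoorCirculationCarryingRigidityConeFluxSubsolution
  (norm_horizontalPart)
open Summit.NavierStokesRegularity.NavierStokesRegularity.Theorems.HalfSpaceWindowDoorCirculationCarryingRigidityConeLiouville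
  (eq_zero_of_coned)

variable {C : ℝ} {v : ℝ → EuclideanSpace ℝ (Fin 3) → EuclideanSpace ℝ (Fin 3)}

/-- **THE CONE THEOREM IN EVERY DIRECTION.**  A door-class profile with `⟪curl v, e⟫ ≥ 0` and the cone `‖ω − ⟪ω, ê⟫ê‖ ≤ K⟪ω, ê⟫` about the unit
vector `ê = ‖e‖⁻¹e` (`e ≠ 0`, `K ≥ 0`) vanishes identically. -/
theorem eq_zero_of_coned_dir (hv : InDoorClass C v) {e : EuclideanSpace ℝ (Fin 3)} (he : e ≠ 0)
    (hnn : ∀ s < 0, ∀ y, 0 ≤ ⟪curl (v s) y, e⟫) {K : ℝ} (hK : 0 ≤ K)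
    (hcone : ∀ s < 0, ∀ y, ‖curl (v s) y - ⟪curl (v s) y, (‖e‖⁻¹ : ℝ) • e⟫ • ((‖e‖⁻¹ : ℝ) • e)‖ ≤ K * ⟪curl (v s) y, (‖e‖⁻¹ : ℝ) • e⟫) :
    ∀ t < 0, ∀ x, v t x = 0 := by
  obtain ⟨hrate, hcont, hmild, hdiv⟩ := hv
  obtain ⟨L, hL, hdet⟩ := exists_linearIsometryEquiv_det_one_symm_single_two he
  obtain ⟨hrate', hcont', hmild', hdiv'⟩ := class_conj_linearIsometryEquiv L hrate hcont hmild hdiv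
  set u : ℝ → EuclideanSpace ℝ (Fin 3) → EuclideanSpace ℝ (Fin 3) := fun t x => L (v t (L.symm x)) with hu
  have hu' : InDoorClass C u := ⟨hrate', hcont', hmild', hdiv'⟩
  set n : EuclideanSpace ℝ (Fin 3) := (‖e‖⁻¹ : ℝ) • e with hn
  have hLn : L n = EuclideanSpace.single 2 1 := by
    have h := congrArg L hL
    rw [LinearIsometryEquiv.apply_symm_apply] at h
    exact h.symm
  -- the pseudovector law with `det L = 1`
  have hcurl : ∀ s y, curl (u s) y = L (curl (v s) (L.symm y)) := by
    intro s y
    have h := curl_conj_linearIsometryEquiv L (v s) y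
    rw [hdet, one_smul] at h
    exact h
  have hinner : ∀ s y, ⟪curl (u s) y, e3⟫ = ⟪curl (v s) (L.symm y), n⟫ := by
    intro s y
    rw [hcurl, show (e3 : EuclideanSpace ℝ (Fin 3)) = EuclideanSpace.single 2 1 from rfl, ← hLn, LinearIsometryEquiv.inner_map_map]
  -- sign and cone pass to the conjugated profile
  have hsign : SignE3 u := by
    intro s hs y
    rw [hinner, hn, inner_smul_right]
    exact mul_nonneg (inv_nonneg.2 (norm_nonneg e)) (hnn s hs (L.symm y))
  have hcone' : ∀ s < 0, ∀ x, Real.sqrt ((curl (u s) x 0) ^ 2 + (curl (u s) x 1) ^ 2) ≤ K * curl (u s) x 2 := by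
    intro s hs x
    have h3 : curl (u s) x 2 = ⟪curl (v s) (L.symm x), n⟫ := by rw [← inner_e3_apply]; exact hinner s x
    have hh : Real.sqrt ((curl (u s) x 0) ^ 2 + (curl (u s) x 1) ^ 2) =
        ‖curl (v s) (L.symm x) - ⟪curl (v s) (L.symm x), n⟫ • n‖ := by
      rw [← norm_horizontalPart (curl (u s) x)]
      have he3 : (Summit.NavierStokesRegularity.NavierStokesRegularity.Theorems.AxisTwistDoorAveragedConeLiouvilleDefs.e3 :
          EuclideanSpace ℝ (Fin 3)) = e3 := rfl
      rw [he3, hinner s x, hcurl, show (e3 : EuclideanSpace ℝ (Fin 3)) = L n from hLn.symm, ← L.map_smul, ← map_sub,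
        LinearIsometryEquiv.norm_map]
    rw [hh, h3]
    exact hcone s hs (L.symm x)
  have hzero := eq_zero_of_coned hu' hsign hK hcone'
  intro t ht x
  have h := hzero t ht (L x)
  have : v t x = L.symm (u t (L x)) := by simp [hu]
  rw [this, h, map_zero]

/-- **In the crux's format**: such a profile is not backward-singular at the apex `(0,0)`. -/
theorem not_isBackwardSingularPoint_of_coned_dir (hv : InDoorClass C v) {e : EuclideanSpace ℝ (Fin 3)} (he : e ≠ 0)
    (hnn : ∀ s < 0, ∀ y, 0 ≤ ⟪curl (v s) y, e⟫) {K : ℝ} (hK : 0 ≤ K)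
    (hcone : ∀ s < 0, ∀ y, ‖curl (v s) y - ⟪curl (v s) y, (‖e‖⁻¹ : ℝ) • e⟫ • ((‖e‖⁻¹ : ℝ) • e)‖ ≤ K * ⟪curl (v s) y, (‖e‖⁻¹ : ℝ) • e⟫) :
    ¬ IsBackwardSingularPoint v 0 := by
  intro hsing
  have h0 := eq_zero_of_coned_dir hv he hnn hK hcone
  have hnorm : eLpNorm (uncurry v) ⊤
      (volume.restrict (parabolicCylinder 1 (0 : ℝ × EuclideanSpace ℝ (Fin 3)))) = 0 := by
    rw [eLpNorm_congr_ae (g := 0) ?_, eLpNorm_zero]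
    filter_upwards [ae_restrict_mem (isOpen_parabolicCylinder _ _).measurableSet] with q hq
    have hq0 : q.1 < 0 := by
      rw [mem_parabolicCylinder] at hq
      simpa using hq.1.2
    exact h0 q.1 hq0 q.2
  have htop := hsing 1 one_pos
  rw [hnorm] at htop
  exact ENNReal.zero_ne_top htop

end Summit.NavierStokesRegularity.NavierStokesRegularity.Theorems.HalfSpaceWindowDoorCirculationCarryingRigidityConeLiouvilleDir

end
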